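/-
Origin: expansion seat `prover-pub-hodgecm-mc-binder-1-g16-0`, handover #R107 2026-08-20T20:18:19Z md5 365b2e7c9589 (340 l.; NEW additive MODEL leaf; imports PKG HodgeCM.Model.CoverInstance + PKG HodgeCM.Model.LevelCoveringTwist only; drops ⇒ {#R108}; NAME LIST: HodgeCM.Model.LevelTranslate.Urat · HodgeCM.Model.LevelTranslate.glι · HodgeCM.Model.LevelTranslate.ballDatum_Hℂ · HodgeCM.Model.LevelTranslate.ballDatum_map_Γ · HodgeCM.Model.LevelTranslate.ι₁_complexConj · HodgeCM.Model.LevelTranslate.map_ι₁_mem_unitaryGroup · HodgeCM.Model.LevelTranslate.map_ι₁_mem_realPoints · HodgeCM.Model.LevelTranslate.TransCond · HodgeCM.Model.LevelTranslate.TransCond.iff · HodgeCM.Model.LevelTranslate.TransCond.apply · HodgeCM.Model.LevelTranslate.TransCond.one_of_le · HodgeCM.Model.LevelTranslate.TransCond.one_self · HodgeCM.Model.LevelTranslate.TransCond.comp · HodgeCM.Model.LevelTranslate.TransCond.of_Γ_eq · HodgeCM.Model.LevelTranslate.TransCond.congr_elt · HodgeCM.Model.LevelTranslate.TransCond.one_trans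 · HodgeCM.Model.LevelTranslate.conjInto_of_transCond · HodgeCM.Model.LevelTranslate.exists_transMor · HodgeCM.Model.LevelTranslate.transMor · HodgeCM.Model.LevelTranslate.map_transMor_unif · HodgeCM.Model.LevelTranslate.pull_congr · HodgeCM.Model.LevelTranslate.map_eq_of_unif · HodgeCM.Model.LevelTranslate.pull_transMor_comp · HodgeCM.Model.LevelTranslate.pull_transMor_one · HodgeCM.Model.LevelTranslate.pull_transMor_congr · HodgeCM.Model.LevelTranslate.pull_levelCover_eq · HodgeCM.Model.LevelTranslate.transMorU · HodgeCM.Model.LevelTranslate.pullC_transMorU · HodgeCM.Model.LevelTranslate.pullC_transMorU_comp_apply · HodgeCM.Model.LevelTranslate.pullC_transMorU_comp · HodgeCM.Model.LevelTranslate.pullC_transMorU_one · HodgeCM.Model.LevelTranslate.pullC_transMorU_congr · HodgeCM.Model.LevelTranslate.pullC_levelCover_eq) (`HOME/mc/pub-hodgecm-mc-binder-1-g16/stage62/HodgeCM/Model/LevelTranslate.lean`, md5 365b2e7c9589, 340 lines);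
landed by the second packager p2 gen 13 (p2-g13) in gate run 62 as `HodgeCM/Model/LevelTranslate.lean` (packager comment re-wording per the RUN-32 precedent (gate audit (5) rejects the proof-placeholder tokens s-o-r-r-y / a-d-m-i-t anywhere in a source, comments included): 1 occurrence(s) inside COMMENTS re-spelt `proof-hole` / `adm-token`; no Lean code byte touched).
-/
/-
Copyright (c) 2026 the pub-hodgecm formalisation cell (harness21).  New file, not vendored.
Origin: session prover-pub-hodgecm-mc-binder-1-g16-0 (unit pub-hodgecm-mc-binder-1-g16, BINDER PROVER gen 16 of lineage mc-binder-1;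
content lane (J-Liu-Θ), (J3) design memo `HOME/mc/pub-hodgecm-mc-axioms-1-g15/J3-DESIGN.md` §3, HECKE-TOWER sub-leaves (T2)/(T3)
«rational translates between the model's Picard modular surfaces and their pull-backs»), 2026-08-20.
-/
import Summits.HodgeConjecture.HodgeCM.Model.CoverInstance
import Summits.HodgeConjecture.HodgeCM.Model.LevelCoveringTwist

/-!
# Rational translates `t_γ : X_{Δ₁} ⟶ X_{Δ₂}` of the model universe and the functoriality of their pull-backs

For the model universe `universeOf hHD hI hU h₃` (`Model/Universe`), one hermitian space `(L, ι₁, V)`, two levels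
`Δ₁ Δ₂ : Level V` and a RATIONAL element `γ ∈ U(V)(L₀) ≤ GL₃(L)` with `γ Δ₁ γ⁻¹ ≤ Δ₂` (`TransCond γ Δ₁ Δ₂`), the
map `Δ₁[v] ↦ Δ₂[γ^{ι₁} v]` of ball quotients is a morphism of the CHOSEN algebraic models

* `transMor hU h₃ hHD hA γ Δ₁ Δ₂ ht : Var.Mor hU h₃ (.pms (pmsCode L ι₁ V Δ₁)) (.pms (pmsCode L ι₁ V Δ₂))`
  (a choice over #R93 `LevelCoveringTwist.exists_hom_map_unif_eq_mulVec` under the record `hA : Arapura2012_Cor_15_4_6`,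
  exactly as `Model/CoverInstance.levelCover` is a choice over `LevelCovering.exists_hom_map_unif_eq`; total, with the
  `ℙ²`-identity off the anisotropic regime), with its junction `map_transMor_unif : t_γ(ℂ) (unif₁ v) = unif₂ (γ^{ι₁} v)`.

The bridge from the PKG's `(L, V.Hm, Δ.Γ)` to the chosen datum's `(E ⊂ ℂ, H, Γ)` is §1 (`ballDatum_Hℂ : Hℂ = V.Hm^{ι₁}`,
`ballDatum_map_Γ : Γ^{τ₁} = Δ.Γ^{ι₁}`, `map_ι₁_mem_realPoints`, `conjInto_of_transCond`).

§3 is what the tower carrier (J3)/(α) consumes: Betti pull-back only sees the map on complex points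
(`pull_congr` — `bettiCohomology.map f := H^k(f(ℂ))` by definition), `unif₁` is onto, hence

* `pull_transMor_comp : t_{γ₁}^* ∘ t_{γ₂}^* = t_{γ₂γ₁}^*` (ANY intermediate level), `pull_transMor_one : t_1^* = id` on `X_Δ`,
  `pull_transMor_congr` (independence of the chosen morphism and of the `TransCond` proof is automatic),
  `pull_levelCover_eq : levelCover^* = t_1^*` (the level covering `X_{Δ'} ⟶ X_Δ`, `Δ' ≤ Δ`, is the translate by `1`).

No record is cited anew (`hA` is the record already behind `coverOf`); nothing is minted; no `proof-hole`.
-/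

noncomputable section

open scoped Matrix
open Matrix Function Set
open NumberField CategoryTheory
open Literature.AlgebraicGeometry.Motives
open Literature.AlgebraicGeometry.ShimuraVarieties
open Literature.AlgebraicGeometry.HodgeTheory
open Literature.NumberTheory.Automorphic
open Literature.NumberTheory.Automorphic.PicardCM
open Literature.NumberTheory.Transcendental (Arapura2012_Cor_15_4_6)

namespace HodgeCM

namespace Model.LevelTranslate

open HodgeCM.Model.LevelCoveringTwist (ConjInto exists_hom_map_unif_eq_mulVec mulVec_mem_cone)

variable (hU : BallQuotientUniformisedDatum) (h₃ : CMAbelianVarietyRealised)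
variable {L : CMField} {ι₁ : L →+* ℂ} {V : HermSpace3 L ι₁}

/-! ## 1. The chosen ball datum of `X_Δ` read against `(L, ι₁, V, Δ)` -/

/-- The rational points `U(V)(L₀) ≤ GL₃(L)` of the unitary group of `V` (vendored `UnitaryGroup.rational`). -/
abbrev Urat (V : HermSpace3 L ι₁) : Subgroup (GL (Fin 3) L) :=
  UnitaryGroup.rational (↥(maximalRealSubfield L)) L (IsCMField.complexConj L) 3 V.Hm

/-- `γ^{ι₁} ∈ GL₃(ℂ)`. -/
abbrev glι (ι₁ : L →+* ℂ) (γ : GL (Fin 3) L) : GL (Fin 3) ℂ := Matrix.GeneralLinearGroup.map ι₁ γ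

/-- The complex Gram matrix of the chosen datum of `X_Δ` is `V.Hm^{ι₁}` (clause `datum_H`). -/
theorem ballDatum_Hℂ (Δ : Level V) (h : (pmsCode L ι₁ V Δ).IsAnisotropic) :
    (Var.ballDatum hU h₃ (pmsCode L ι₁ V Δ) h).Hℂ = V.Hm.map ι₁ := by
  change ((pmsRealisation hU _).datum h).H.map ((pmsRealisation hU _).datum h).E.subtype = _
  rw [(pmsRealisation hU (pmsCode L ι₁ V Δ)).datum_H h]
  ext i j; rfl

/-- The group of the chosen datum of `X_Δ`, read in `GL₃(ℂ)`, is `Δ.Γ^{ι₁}` (clause `datum_Γ`). -/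
theorem ballDatum_map_Γ (Δ : Level V) (h : (pmsCode L ι₁ V Δ).IsAnisotropic) :
    (Var.ballDatum hU h₃ (pmsCode L ι₁ V Δ) h).Γ.map
        (Matrix.GeneralLinearGroup.map (Var.ballDatum hU h₃ (pmsCode L ι₁ V Δ) h).τ₁) =
      Δ.Γ.map (Matrix.GeneralLinearGroup.map ι₁) := by
  change ((pmsRealisation hU _).datum h).Γ.map
      (Matrix.GeneralLinearGroup.map ((pmsRealisation hU _).datum h).E.subtype) = _
  rw [(pmsRealisation hU (pmsCode L ι₁ V Δ)).datum_Γ h]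
  change (Δ.Γ.map (Matrix.GeneralLinearGroup.map ι₁.rangeRestrictFieldEquiv.toRingHom)).map _ = _
  rw [Subgroup.map_map]
  congr 1

/-- `ι₁` intertwines the CM conjugation with complex conjugation (`IsCMField.complexEmbedding_complexConj`). -/
theorem ι₁_complexConj (x : L) :
    ι₁ (((IsCMField.complexConj L : L ≃ₐ[↥(maximalRealSubfield L)] L) : L →+* L) x) = starRingEnd ℂ (ι₁ x) :=
  IsCMField.complexEmbedding_complexConj L ι₁ x

/-- A rational isometry acts on `V_{ι₁}` by an element of the real group `U(V.Hm^{ι₁})`. -/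
theorem map_ι₁_mem_unitaryGroup {γ : GL (Fin 3) L} (hγ : γ ∈ Urat V) :
    glι ι₁ γ ∈ unitaryGroup (starRingEnd ℂ) (V.Hm.map ι₁) := by
  rw [Literature.AlgebraicGeometry.ShimuraVarieties.mem_unitaryGroup_iff]
  exact (mem_unitaryGroupOfForm_iff.mp (map_mem_unitaryGroupOfForm ι₁ ι₁_complexConj hγ))

/-- … hence by an element of the real group `G_D = U(H^{τ₁})` of the chosen datum of `X_Δ`. -/
theorem map_ι₁_mem_realPoints {γ : GL (Fin 3) L} (hγ : γ ∈ Urat V) (Δ : Level V) (h : (pmsCode L ι₁ V Δ).IsAnisotropic) :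
    glι ι₁ γ ∈ (Var.ballDatum hU h₃ (pmsCode L ι₁ V Δ) h).realPoints := by
  change glι ι₁ γ ∈ unitaryGroup (starRingEnd ℂ) (Var.ballDatum hU h₃ (pmsCode L ι₁ V Δ) h).Hℂ
  rw [ballDatum_Hℂ]
  exact map_ι₁_mem_unitaryGroup hγ

/-- **`γ` translates `Δ₁` into `Δ₂`**: `γ Δ₁ γ⁻¹ ≤ Δ₂` in `GL₃(L)`. -/
def TransCond (γ : GL (Fin 3) L) (Δ₁ Δ₂ : Level V) : Prop := Δ₁.Γ.map (MulAut.conj γ).toMonoidHom ≤ Δ₂.Γ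

namespace TransCond

variable {γ γ₁ γ₂ : GL (Fin 3) L} {Δ Δ₁ Δ₂ Δ₃ : Level V}

/-- (Ported verbatim from the HodgeCMPerL package; no docstring in the source.) -/
theorem iff : TransCond γ Δ₁ Δ₂ ↔ ∀ δ ∈ Δ₁.Γ, γ * δ * γ⁻¹ ∈ Δ₂.Γ := by
  rw [TransCond, Subgroup.map_le_iff_le_comap]
  exact ⟨fun h δ hδ ↦ by simpa using h hδ, fun h δ hδ ↦ by simpa using h δ hδ⟩

/-- (Ported verbatim from the HodgeCMPerL package; no docstring in the source.) -/
theorem apply (h : TransCond γ Δ₁ Δ₂) {δ : GL (Fin 3) L} (hδ : δ ∈ Δ₁.Γ) : γ * δ * γ⁻¹ ∈ Δ₂.Γ := iff.mp h δ hδ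

/-- `Δ' ≤ Δ` in `GL₃(L)` is `TransCond 1 Δ' Δ` (the level coverings). -/
theorem one_of_le (h : Δ₁.Γ ≤ Δ₂.Γ) : TransCond 1 Δ₁ Δ₂ := iff.mpr fun δ hδ ↦ by simpa using h hδ

/-- (Ported verbatim from the HodgeCMPerL package; no docstring in the source.) -/
theorem one_self : TransCond 1 Δ Δ := one_of_le le_rfl

/-- Translation conditions compose: `γ₁ Δ₁ γ₁⁻¹ ≤ Δ₂`, `γ₂ Δ₂ γ₂⁻¹ ≤ Δ₃` ⇒ `(γ₂γ₁) Δ₁ (γ₂γ₁)⁻¹ ≤ Δ₃`. -/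
theorem comp (h₁ : TransCond γ₁ Δ₁ Δ₂) (h₂ : TransCond γ₂ Δ₂ Δ₃) : TransCond (γ₂ * γ₁) Δ₁ Δ₃ :=
  iff.mpr fun δ hδ ↦ by
    have := h₂.apply (h₁.apply hδ)
    rwa [show γ₂ * γ₁ * δ * (γ₂ * γ₁)⁻¹ = γ₂ * (γ₁ * δ * γ₁⁻¹) * γ₂⁻¹ by group]

/-- (Ported verbatim from the HodgeCMPerL package; no docstring in the source.) -/
theorem of_Γ_eq (h : Δ₁.Γ.map (MulAut.conj γ).toMonoidHom = Δ₂.Γ) : TransCond γ Δ₁ Δ₂ := h.le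

/-- Transport along an equality of the translating elements (use to normalise `γ * 1`, `1 * γ`, `1 * 1`). -/
theorem congr_elt {γ' : GL (Fin 3) L} (h : TransCond γ Δ₁ Δ₂) (e : γ = γ') : TransCond γ' Δ₁ Δ₂ := e ▸ h

/-- `TransCond 1` is transitive. -/
theorem one_trans (h₁ : TransCond 1 Δ₁ Δ₂) (h₂ : TransCond 1 Δ₂ Δ₃) : TransCond 1 Δ₁ Δ₃ :=
  (h₁.comp h₂).congr_elt (mul_one 1)

end TransCond

/-- `TransCond γ Δ₁ Δ₂` is #R93's `ConjInto` for the chosen data of `X_{Δ₁}`, `X_{Δ₂}` and `g = γ^{ι₁}`. -/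
theorem conjInto_of_transCond {γ : GL (Fin 3) L} {Δ₁ Δ₂ : Level V} (ht : TransCond γ Δ₁ Δ₂)
    (h₁ : (pmsCode L ι₁ V Δ₁).IsAnisotropic) (h₂ : (pmsCode L ι₁ V Δ₂).IsAnisotropic) :
    ConjInto (Var.ballDatum hU h₃ (pmsCode L ι₁ V Δ₁) h₁) (Var.ballDatum hU h₃ (pmsCode L ι₁ V Δ₂) h₂) (glι ι₁ γ) := by
  intro δ hδ
  have hδ' : Matrix.GeneralLinearGroup.map (Var.ballDatum hU h₃ (pmsCode L ι₁ V Δ₁) h₁).τ₁ δ ∈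
      Δ₁.Γ.map (Matrix.GeneralLinearGroup.map ι₁) := by
    rw [← ballDatum_map_Γ hU h₃ Δ₁ h₁]; exact Subgroup.mem_map_of_mem _ hδ
  obtain ⟨δ₀, hδ₀, hδeq⟩ := Subgroup.mem_map.mp hδ'
  rw [ballDatum_map_Γ hU h₃ Δ₂ h₂, ← hδeq]
  refine Subgroup.mem_map.mpr ⟨γ * δ₀ * γ⁻¹, ht.apply hδ₀, ?_⟩
  simp only [map_mul, map_inv]

/-! ## 2. The translate morphism -/

section Exists

/-- **The rational translate is a morphism of the models** (anisotropic regime): #R93 on the two chosen data (same `Hℂ`,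
`γ^{ι₁} ∈ G_D`, `ConjInto`), read in the chosen real Hodge models, under `hA`. -/
theorem exists_transMor (hHD : exists_isReal_hodgeModel) (hA : Arapura2012_Cor_15_4_6) {γ : GL (Fin 3) L} (hγ : γ ∈ Urat V) {Δ₁ Δ₂ : Level V} (ht : TransCond γ Δ₁ Δ₂)
    (h₁ : (pmsCode L ι₁ V Δ₁).IsAnisotropic) (h₂ : (pmsCode L ι₁ V Δ₂).IsAnisotropic) :
    ∃ f : Var.scheme hU h₃ (.pms (pmsCode L ι₁ V Δ₁)) ⟶ Var.scheme hU h₃ (.pms (pmsCode L ι₁ V Δ₂)),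
      ∀ v ∈ (Var.ballDatum hU h₃ (pmsCode L ι₁ V Δ₁) h₁).cone,
        AlgPoints.map f ((Var.ballDatum hU h₃ (pmsCode L ι₁ V Δ₁) h₁).unif v) =
          (Var.ballDatum hU h₃ (pmsCode L ι₁ V Δ₂) h₂).unif ((glι ι₁ γ : Matrix (Fin 3) (Fin 3) ℂ) *ᵥ v) :=
  exists_hom_map_unif_eq_mulVec hA (ballDatum_Hℂ_eq hU h₃ Δ₂ Δ₁ h₁ h₂) (map_ι₁_mem_realPoints hU h₃ hγ Δ₂ h₂)
    (conjInto_of_transCond hU h₃ ht h₁ h₂)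
    (BettiUniverse.realHodgeModel hHD (Var.isSmoothProjective hU h₃ (.pms (pmsCode L ι₁ V Δ₁))))
    (BettiUniverse.realHodgeModel hHD (Var.isSmoothProjective hU h₃ (.pms (pmsCode L ι₁ V Δ₂))))

open scoped Classical in
/-- **The translate `t_γ : X_{Δ₁} ⟶ X_{Δ₂}`, `Δ₁[v] ↦ Δ₂[γ^{ι₁} v]`, of the model universe** (`γ ∈ U(V)(L₀)`,
`γ Δ₁ γ⁻¹ ≤ Δ₂`): the chosen morphism of `exists_transMor` in the anisotropic regime, the identity of `ℙ²` off it. -/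
def transMor (hHD : exists_isReal_hodgeModel) (hA : Arapura2012_Cor_15_4_6) {γ : GL (Fin 3) L} (hγ : γ ∈ Urat V)
    (Δ₁ Δ₂ : Level V) (ht : TransCond γ Δ₁ Δ₂) :
    Var.Mor hU h₃ (.pms (pmsCode L ι₁ V Δ₁)) (.pms (pmsCode L ι₁ V Δ₂)) :=
  if h : IsAnisotropic L V.Hm then
    (exists_transMor hU h₃ hHD hA hγ ht (isAnisotropic_pmsCode_of Δ₂ Δ₁ h).1 (isAnisotropic_pmsCode_of Δ₂ Δ₁ h).2).choose
  else
    eqToHom (by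
      rw [scheme_pms_of_not_isAnisotropic hU h₃ _ (fun h' ↦ h ((isAnisotropic_pmsCode_iff L ι₁ V Δ₁).1 h')),
        scheme_pms_of_not_isAnisotropic hU h₃ _ (fun h' ↦ h ((isAnisotropic_pmsCode_iff L ι₁ V Δ₂).1 h'))])

/-- **Junction**: `t_γ(ℂ) (unif₁ v) = unif₂ (γ^{ι₁} v)` on the cone (anisotropic regime). -/
theorem map_transMor_unif (hHD : exists_isReal_hodgeModel) (hA : Arapura2012_Cor_15_4_6) {γ : GL (Fin 3) L}
    (hγ : γ ∈ Urat V) {Δ₁ Δ₂ : Level V} (ht : TransCond γ Δ₁ Δ₂) (h : IsAnisotropic L V.Hm) {v : Fin 3 → ℂ}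
    (hv : v ∈ (Var.ballDatum hU h₃ (pmsCode L ι₁ V Δ₁) ((isAnisotropic_pmsCode_iff L ι₁ V Δ₁).2 h)).cone) :
    AlgPoints.map (transMor hU h₃ hHD hA hγ Δ₁ Δ₂ ht)
        ((Var.ballDatum hU h₃ (pmsCode L ι₁ V Δ₁) ((isAnisotropic_pmsCode_iff L ι₁ V Δ₁).2 h)).unif v) =
      (Var.ballDatum hU h₃ (pmsCode L ι₁ V Δ₂) ((isAnisotropic_pmsCode_iff L ι₁ V Δ₂).2 h)).unif
        ((glι ι₁ γ : Matrix (Fin 3) (Fin 3) ℂ) *ᵥ v) := by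
  unfold transMor
  rw [dif_pos h]
  exact (exists_transMor hU h₃ hHD hA hγ ht (isAnisotropic_pmsCode_of Δ₂ Δ₁ h).1
    (isAnisotropic_pmsCode_of Δ₂ Δ₁ h).2).choose_spec v hv

end Exists

/-! ## 3. Pull-backs of translates: functoriality -/

/-- **Betti pull-back only sees the map on complex points** (`bettiCohomology.map f = H^k(f(ℂ))` by definition). -/
theorem pull_congr {X Y : SchemeOver ℂ} {f f' : X ⟶ Y} (h : ∀ P : ComplexPoints X, AlgPoints.map f P = AlgPoints.map f' P)
    (k : ℕ) :
    BettiUniverse.pull f k = BettiUniverse.pull f' k := by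
  have hc : AlgPoints.mapContinuous (L := ℂ) f = AlgPoints.mapContinuous f' :=
    ContinuousMap.ext fun P ↦ by rw [AlgPoints.mapContinuous_apply, AlgPoints.mapContinuous_apply, h P]
  change (bettiCohomology.map f k).hom = (bettiCohomology.map f' k).hom
  rw [bettiCohomology.map, bettiCohomology.map, hc]

/-- Off the anisotropic regime every two pull-backs between surfaces of the model agree iff … — not needed; in the
regime, a morphism out of `X_{Δ₁}` is determined ON COMPLEX POINTS by its values on `unif₁ v` (`unif₁` is onto). -/
theorem map_eq_of_unif {Δ₁ : Level V} (h₁ : (pmsCode L ι₁ V Δ₁).IsAnisotropic) {Y : SchemeOver ℂ}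
    {f f' : Var.scheme hU h₃ (.pms (pmsCode L ι₁ V Δ₁)) ⟶ Y}
    (h : ∀ v ∈ (Var.ballDatum hU h₃ (pmsCode L ι₁ V Δ₁) h₁).cone,
      AlgPoints.map f ((Var.ballDatum hU h₃ (pmsCode L ι₁ V Δ₁) h₁).unif v) =
        AlgPoints.map f' ((Var.ballDatum hU h₃ (pmsCode L ι₁ V Δ₁) h₁).unif v))
    (P : ComplexPoints (Var.scheme hU h₃ (.pms (pmsCode L ι₁ V Δ₁)))) :
    AlgPoints.map f P = AlgPoints.map f' P := by
  obtain ⟨v, hv, rfl⟩ := (Var.ballDatum hU h₃ (pmsCode L ι₁ V Δ₁) h₁).surjOn_unif (mem_univ P)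
  exact h v hv

section Functoriality

variable (hHD : exists_isReal_hodgeModel) (hA : Arapura2012_Cor_15_4_6)
include hHD hA

/-- **`t_{γ₁}^* ∘ t_{γ₂}^* = t_{γ₂ γ₁}^*`** on `Hᵏ(X_{Δ₃}(ℂ); ℚ) → Hᵏ(X_{Δ₁}(ℂ); ℚ)`, through ANY intermediate level `Δ₂`
(`(t_{γ₁} ≫ t_{γ₂})(ℂ)` and `t_{γ₂γ₁}(ℂ)` agree: both send `Δ₁[v]` to `Δ₃[γ₂ γ₁ v]`). -/
theorem pull_transMor_comp {γ₁ γ₂ : GL (Fin 3) L} (hγ₁ : γ₁ ∈ Urat V) (hγ₂ : γ₂ ∈ Urat V) {Δ₁ Δ₂ Δ₃ : Level V}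
    (ht₁ : TransCond γ₁ Δ₁ Δ₂) (ht₂ : TransCond γ₂ Δ₂ Δ₃) (ht : TransCond (γ₂ * γ₁) Δ₁ Δ₃) (k : ℕ) :
    BettiUniverse.pull (transMor hU h₃ hHD hA hγ₁ Δ₁ Δ₂ ht₁) k ∘ₗ BettiUniverse.pull (transMor hU h₃ hHD hA hγ₂ Δ₂ Δ₃ ht₂) k =
      BettiUniverse.pull (transMor hU h₃ hHD hA (Subgroup.mul_mem _ hγ₂ hγ₁) Δ₁ Δ₃ ht) k := by
  rw [← BettiUniverse.pull_comp]
  by_cases h : IsAnisotropic L V.Hm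
  · refine pull_congr (map_eq_of_unif hU h₃ ((isAnisotropic_pmsCode_iff L ι₁ V Δ₁).2 h) fun v hv ↦ ?_) k
    have h₁ := (isAnisotropic_pmsCode_iff L ι₁ V Δ₁).2 h
    have h₂ := (isAnisotropic_pmsCode_iff L ι₁ V Δ₂).2 h
    have hv₂ : (glι ι₁ γ₁ : Matrix (Fin 3) (Fin 3) ℂ) *ᵥ v ∈ (Var.ballDatum hU h₃ (pmsCode L ι₁ V Δ₂) h₂).cone :=
      mulVec_mem_cone (ballDatum_Hℂ_eq hU h₃ Δ₂ Δ₁ h₁ h₂) (map_ι₁_mem_realPoints hU h₃ hγ₁ Δ₂ h₂) hv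
    rw [AlgPoints.map_comp_apply, map_transMor_unif hU h₃ hHD hA hγ₁ ht₁ h hv,
      map_transMor_unif hU h₃ hHD hA hγ₂ ht₂ h hv₂, map_transMor_unif hU h₃ hHD hA _ ht h hv, mulVec_mulVec,
      ← Units.val_mul, ← map_mul]
  · -- off the regime all three are identities of `ℙ²`
    unfold transMor
    simp only [dif_neg h, eqToHom_trans]

/-- **`t_1^* = id`** on `Hᵏ(X_Δ(ℂ); ℚ)` (`t_1(ℂ) = id` on points). -/
theorem pull_transMor_one {Δ : Level V} (ht : TransCond 1 Δ Δ) (k : ℕ) :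
    BettiUniverse.pull (transMor hU h₃ hHD hA (Subgroup.one_mem (Urat V)) Δ Δ ht) k = LinearMap.id := by
  rw [← BettiUniverse.pull_id]
  by_cases h : IsAnisotropic L V.Hm
  · refine pull_congr (map_eq_of_unif hU h₃ ((isAnisotropic_pmsCode_iff L ι₁ V Δ).2 h) fun v hv ↦ ?_) k
    rw [map_transMor_unif hU h₃ hHD hA _ ht h hv, AlgPoints.map_id_apply]
    simp only [glι, map_one, Units.val_one, one_mulVec]
  · unfold transMor
    simp only [dif_neg h, eqToHom_refl]

/-- The pull-back of a translate depends only on `(γ, Δ₁, Δ₂)`: two elements with the same image in `GL₃(ℂ)`… in fact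
only on `γ^{ι₁}`; here the form used downstream — equal `γ`'s, any membership / condition proofs. -/
theorem pull_transMor_congr {γ γ' : GL (Fin 3) L} (hγ : γ ∈ Urat V) (hγ' : γ' ∈ Urat V) (e : γ = γ') {Δ₁ Δ₂ : Level V}
    (ht : TransCond γ Δ₁ Δ₂) (ht' : TransCond γ' Δ₁ Δ₂) (k : ℕ) :
    BettiUniverse.pull (transMor hU h₃ hHD hA hγ Δ₁ Δ₂ ht) k = BettiUniverse.pull (transMor hU h₃ hHD hA hγ' Δ₁ Δ₂ ht') k := by
  subst e; rfl

/-- **The level covering is the translate by `1`**: `levelCover^* = t_1^*` (`Δ' ≤ Δ` in `GL₃(L)`). -/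
theorem pull_levelCover_eq {Δ Δ' : Level V} (hle : Δ'.Γ ≤ Δ.Γ) (k : ℕ) :
    BettiUniverse.pull (levelCover hU h₃ hHD hA Δ Δ' hle) k =
      BettiUniverse.pull (transMor hU h₃ hHD hA (Subgroup.one_mem (Urat V)) Δ' Δ (TransCond.one_of_le hle)) k := by
  by_cases h : IsAnisotropic L V.Hm
  · refine pull_congr (map_eq_of_unif hU h₃ ((isAnisotropic_pmsCode_iff L ι₁ V Δ').2 h) fun v hv ↦ ?_) k
    rw [map_levelCover_unif hU h₃ hHD hA hle h hv, map_transMor_unif hU h₃ hHD hA _ _ h hv]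
    simp only [glι, map_one, Units.val_one, one_mulVec]
  · unfold transMor levelCover
    simp only [dif_neg h]

end Functoriality

/-! ## 4. On the end-state universe: `U.pullC` forms -/

section EndState

variable (hHD : exists_isReal_hodgeModel) (hI : hodgePQ_independent_of_hodgeModel) (hA : Arapura2012_Cor_15_4_6)

/-- The translate as a morphism of the model universe `universeOf hHD hI hU h₃` between `U.pms L ι₁ V Δ₁` and
`U.pms L ι₁ V Δ₂`. -/
abbrev transMorU {γ : GL (Fin 3) L} (hγ : γ ∈ Urat V) (Δ₁ Δ₂ : Level V) (ht : TransCond γ Δ₁ Δ₂) :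
    (universeOf hHD hI hU h₃).Mor ((universeOf hHD hI hU h₃).pms L ι₁ V Δ₁) ((universeOf hHD hI hU h₃).pms L ι₁ V Δ₂) :=
  transMor hU h₃ hHD hA hγ Δ₁ Δ₂ ht

/-- `U.pullC (t_γ) k = (t_γ^*) ⊗ ℂ`. -/
theorem pullC_transMorU {γ : GL (Fin 3) L} (hγ : γ ∈ Urat V) (Δ₁ Δ₂ : Level V) (ht : TransCond γ Δ₁ Δ₂) (k : ℕ) :
    (universeOf hHD hI hU h₃).pullC (transMorU hU h₃ hHD hI hA hγ Δ₁ Δ₂ ht) k =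
      (BettiUniverse.pull (transMor hU h₃ hHD hA hγ Δ₁ Δ₂ ht) k).baseChange ℂ := rfl

/-- **`t_{γ₁}^* ∘ t_{γ₂}^* = t_{γ₂γ₁}^*` on `U.CohC`**, pointwise. -/
theorem pullC_transMorU_comp_apply {γ₁ γ₂ : GL (Fin 3) L} (hγ₁ : γ₁ ∈ Urat V) (hγ₂ : γ₂ ∈ Urat V) {Δ₁ Δ₂ Δ₃ : Level V}
    (ht₁ : TransCond γ₁ Δ₁ Δ₂) (ht₂ : TransCond γ₂ Δ₂ Δ₃) (ht : TransCond (γ₂ * γ₁) Δ₁ Δ₃) (k : ℕ)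
    (x : (universeOf hHD hI hU h₃).CohC ((universeOf hHD hI hU h₃).pms L ι₁ V Δ₃) k) :
    (universeOf hHD hI hU h₃).pullC (transMorU hU h₃ hHD hI hA hγ₁ Δ₁ Δ₂ ht₁) k
        ((universeOf hHD hI hU h₃).pullC (transMorU hU h₃ hHD hI hA hγ₂ Δ₂ Δ₃ ht₂) k x) =
      (universeOf hHD hI hU h₃).pullC (transMorU hU h₃ hHD hI hA (Subgroup.mul_mem _ hγ₂ hγ₁) Δ₁ Δ₃ ht) k x := by
  change ((BettiUniverse.pull (transMor hU h₃ hHD hA hγ₁ Δ₁ Δ₂ ht₁) k).baseChange ℂ ∘ₗ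
      (BettiUniverse.pull (transMor hU h₃ hHD hA hγ₂ Δ₂ Δ₃ ht₂) k).baseChange ℂ) x =
    ((BettiUniverse.pull (transMor hU h₃ hHD hA (Subgroup.mul_mem _ hγ₂ hγ₁) Δ₁ Δ₃ ht) k).baseChange ℂ) x
  rw [← LinearMap.baseChange_comp, pull_transMor_comp hU h₃ hHD hA hγ₁ hγ₂ ht₁ ht₂ ht]

/-- **`t_{γ₁}^* ∘ t_{γ₂}^* = t_{γ₂γ₁}^*` on `U.CohC`.** -/
theorem pullC_transMorU_comp {γ₁ γ₂ : GL (Fin 3) L} (hγ₁ : γ₁ ∈ Urat V) (hγ₂ : γ₂ ∈ Urat V) {Δ₁ Δ₂ Δ₃ : Level V}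
    (ht₁ : TransCond γ₁ Δ₁ Δ₂) (ht₂ : TransCond γ₂ Δ₂ Δ₃) (ht : TransCond (γ₂ * γ₁) Δ₁ Δ₃) (k : ℕ) :
    (universeOf hHD hI hU h₃).pullC (transMorU hU h₃ hHD hI hA hγ₁ Δ₁ Δ₂ ht₁) k ∘ₗ
        (universeOf hHD hI hU h₃).pullC (transMorU hU h₃ hHD hI hA hγ₂ Δ₂ Δ₃ ht₂) k =
      (universeOf hHD hI hU h₃).pullC (transMorU hU h₃ hHD hI hA (Subgroup.mul_mem _ hγ₂ hγ₁) Δ₁ Δ₃ ht) k :=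
  LinearMap.ext fun x ↦ pullC_transMorU_comp_apply hU h₃ hHD hI hA hγ₁ hγ₂ ht₁ ht₂ ht k x

/-- **`t_1^* = id` on `U.CohC`.** -/
theorem pullC_transMorU_one {Δ : Level V} (ht : TransCond 1 Δ Δ) (k : ℕ) :
    (universeOf hHD hI hU h₃).pullC (transMorU hU h₃ hHD hI hA (Subgroup.one_mem (Urat V)) Δ Δ ht) k = LinearMap.id := by
  rw [pullC_transMorU, pull_transMor_one, LinearMap.baseChange_id]
  rfl

/-- `U.pullC` of a translate depends only on `γ` (and the levels). -/
theorem pullC_transMorU_congr {γ γ' : GL (Fin 3) L} (hγ : γ ∈ Urat V) (hγ' : γ' ∈ Urat V) (e : γ = γ') {Δ₁ Δ₂ : Level V}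
    (ht : TransCond γ Δ₁ Δ₂) (ht' : TransCond γ' Δ₁ Δ₂) (k : ℕ) :
    (universeOf hHD hI hU h₃).pullC (transMorU hU h₃ hHD hI hA hγ Δ₁ Δ₂ ht) k =
      (universeOf hHD hI hU h₃).pullC (transMorU hU h₃ hHD hI hA hγ' Δ₁ Δ₂ ht') k := by
  subst e; rfl

/-- `U.pullC (levelCover Δ Δ') k = U.pullC (t_1 : X_{Δ'} ⟶ X_Δ) k`. -/
theorem pullC_levelCover_eq {Δ Δ' : Level V} (hle : Δ'.Γ ≤ Δ.Γ) (k : ℕ) :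
    (universeOf hHD hI hU h₃).pullC (X := (universeOf hHD hI hU h₃).pms L ι₁ V Δ')
        (Y := (universeOf hHD hI hU h₃).pms L ι₁ V Δ) (levelCover hU h₃ hHD hA Δ Δ' hle) k =
      (universeOf hHD hI hU h₃).pullC
        (transMorU hU h₃ hHD hI hA (Subgroup.one_mem (Urat V)) Δ' Δ (TransCond.one_of_le hle)) k := by
  change (BettiUniverse.pull (levelCover hU h₃ hHD hA Δ Δ' hle) k).baseChange ℂ = _
  rw [pull_levelCover_eq hU h₃ hHD hA hle k]
  rfl

end EndState

end Model.LevelTranslate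

end HodgeCM

end
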